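import Mathlib
import Literature.MathematicalPhysics.QuantumFieldTheory.Luscher2010.TrivializingMaps
import Literature.MathematicalPhysics.QuantumFieldTheory.Luscher2010.FlowActionSeries
import Summits.Ventures.LatticeQCDFlow.TrivializingMaps.Truncation
import Summits.Ventures.LatticeQCDFlow.TrivializingMaps.TruncationDefect
import Summits.Ventures.LatticeQCDFlow.TrivializingMaps.HaarByPartsZeroModes
import HarnessLib

/-!
# Uniqueness of Lüscher's flow-action series up to additive constants

HONEST FRAMING: exact (Metropolis-corrected) sampling algorithms for lattice gauge theory; figures of merit are
autocorrelation/cost numbers at stated couplings and volumes; no continuum-physics claim.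

Lüscher §4.3 (after eq. (4.15)): since the constant function is the only zero mode of `Δ`, the right-hand
sides of the recursion (4.12)–(4.13) determine the actions `S̃^{(k)}` "unambiguously up to an irrelevant
additive constant". Using the zero-mode theorem of the file `HaarByPartsZeroModes` (theory-1's `HaarIntegrationByParts`, renamed at landing)
(`linkDeriv_eq_zero_of_linkLap_eq_const`), this file proves, for smooth ambient representatives:
* `IsLuscherSeries.linkDeriv_eq`: two solutions of the recursion for the same action have, for every order
  `k`, the same constant `Ċ^{(k)}` and the same link gradients `∂^a_e S̃^{(k)}` on `SU(n)^E`
  (`IsLuscherSeries.const_eq`);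
* `IsLuscherSeries.luscherV_eq`: hence the defect density `𝓥_S S̃^{(N)}` of the order-`N` truncation (file
  `Truncation`) is the same for all solutions — the `∀ Sk`-quantified venture targets `ExtensiveDefect` /
  `DefectSupBound` concern one well-defined function, and the generator `Z_t = -∂S̃_t` of the (truncated)
  trivializing flow does not depend on the chosen solution.

References: M. Lüscher, Trivializing maps, the Wilson flow and the HMC algorithm, CMP 293 (2010) 899
[Luscher2010Trivializing, arXiv:0907.5491], §4.3 eqs. (4.12)–(4.15), §4.5.
-/

namespace Summit.Ventures.LatticeQCDFlow.TrivializingMaps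

open MeasureTheory
open Literature.MathematicalPhysics.QuantumFieldTheory
open Literature.MathematicalPhysics.QuantumFieldTheory.Luscher2010
open scoped Matrix Matrix.Norms.Frobenius ContDiff

variable {d L n : ℕ}

section Uniqueness

variable [NeZero L]

/-- **The recursion (4.12)–(4.13) determines `∂S̃^{(k)}` and `Ċ^{(k)}` uniquely.** Two families of smooth
ambient field functionals solving Lüscher's recursion on `SU(n)^E` for the same action `S` (any basis-indexed
presentation `IsLuscherSeries B S`) have, for every order `k`, the same constant `Ċ^{(k)}` and the same link
derivatives `∂^a_{x,μ} S̃^{(k)}` at every point of the field manifold: by induction on `k`, the difference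
`S̃^{(k)} - S̃'^{(k)}` has constant Laplacian `Ċ^{(k)} - Ċ'^{(k)}` on `SU(n)^E`, hence
(`linkDeriv_eq_zero_of_linkLap_eq_const`) vanishing gradient and `Ċ^{(k)} = Ċ'^{(k)}`. In particular the
generator `Z_t = -∑_k t^k ∂S̃^{(k)}` of the (truncated) trivializing flow is independent of the solution
chosen. [cite: Luscher2010Trivializing, §4.3 eqs. (4.12)–(4.15)] -/
theorem IsLuscherSeries.linkDeriv_eq {B : SuBasis n} {S : AmbConfig d L n → ℝ}
    {Sk Sk' : ℕ → AmbConfig d L n → ℝ} {c c' : ℕ → ℝ}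
    (h : IsLuscherSeries B S Sk c) (h' : IsLuscherSeries B S Sk' c')
    (hsm : ∀ k, ContDiff ℝ ∞ (Sk k)) (hsm' : ∀ k, ContDiff ℝ ∞ (Sk' k)) (k : ℕ) :
    c k = c' k ∧ ∀ (e : Edge d L) (a : B.ι) (U : GaugeConfig d L (Matrix.specialUnitaryGroup (Fin n) ℂ)),
      linkDeriv e (B.T a) (Sk k) (WilsonFlow.coeConfig U) =
        linkDeriv e (B.T a) (Sk' k) (WilsonFlow.coeConfig U) := by
  -- generic step: a constant Laplacian of the difference forces equal constants and equal gradients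
  have main : ∀ k, (∀ U : GaugeConfig d L (Matrix.specialUnitaryGroup (Fin n) ℂ),
      linkLap B (fun W => Sk k W - Sk' k W) (WilsonFlow.coeConfig U) = c k - c' k) →
      (c k = c' k ∧ ∀ (e : Edge d L) (a : B.ι)
        (U : GaugeConfig d L (Matrix.specialUnitaryGroup (Fin n) ℂ)),
        linkDeriv e (B.T a) (Sk k) (WilsonFlow.coeConfig U) =
          linkDeriv e (B.T a) (Sk' k) (WilsonFlow.coeConfig U)) := by
    intro k hL
    obtain ⟨hκ, hD⟩ := linkDeriv_eq_zero_of_linkLap_eq_const B ((hsm k).sub (hsm' k)) hL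
    refine ⟨by linarith, fun e a U => ?_⟩
    have h0 := hD e a U
    rw [linkDeriv_sub_of_differentiableAt e (B.T a) ((hsm k).differentiable (by simp) _)
      ((hsm' k).differentiable (by simp) _)] at h0
    linarith
  induction k with
  | zero =>
    refine main 0 fun U => ?_
    rw [linkLap_sub_of_contDiff B (hsm 0) (hsm' 0), h.1 U, h'.1 U]
    ring
  | succ k ih =>
    refine main (k + 1) fun U => ?_
    rw [linkLap_sub_of_contDiff B (hsm (k + 1)) (hsm' (k + 1)), h.2 k U, h'.2 k U]
    have hs : ∑ e : Edge d L, ∑ a : B.ι, linkDeriv e (B.T a) S (WilsonFlow.coeConfig U) *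
        linkDeriv e (B.T a) (Sk k) (WilsonFlow.coeConfig U) =
        ∑ e : Edge d L, ∑ a : B.ι, linkDeriv e (B.T a) S (WilsonFlow.coeConfig U) *
          linkDeriv e (B.T a) (Sk' k) (WilsonFlow.coeConfig U) := by
      simp only [ih.2]
    rw [hs]
    ring

/-- Consequently the **defect density** `𝓥_S S̃^{(N)} = ∑ ∂^a S · ∂^a S̃^{(N)}` of the order-`N` truncation
(file `Truncation`, `truncationDefectIdentity_holds`) is the same for every smooth solution of the recursion:
the venture targets `ExtensiveDefect` / `DefectSupBound`, quantified over all solutions `Sk`, concern one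
well-defined function on `SU(n)^E`. [cite: Luscher2010Trivializing, §4.3 eqs. (4.12)–(4.15), §4.5] -/
theorem IsLuscherSeries.luscherV_eq {B : SuBasis n} {S : AmbConfig d L n → ℝ}
    {Sk Sk' : ℕ → AmbConfig d L n → ℝ} {c c' : ℕ → ℝ}
    (h : IsLuscherSeries B S Sk c) (h' : IsLuscherSeries B S Sk' c')
    (hsm : ∀ k, ContDiff ℝ ∞ (Sk k)) (hsm' : ∀ k, ContDiff ℝ ∞ (Sk' k)) (N : ℕ)
    (U : GaugeConfig d L (Matrix.specialUnitaryGroup (Fin n) ℂ)) :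
    luscherV B S (Sk N) (WilsonFlow.coeConfig U) = luscherV B S (Sk' N) (WilsonFlow.coeConfig U) := by
  unfold luscherV
  simp only [(IsLuscherSeries.linkDeriv_eq h h' hsm hsm' N).2]

/-- … and so are the constants: `Ċ^{(k)} = Ċ'^{(k)}` for all `k`. [cite: Luscher2010Trivializing, §4.3] -/
theorem IsLuscherSeries.const_eq {B : SuBasis n} {S : AmbConfig d L n → ℝ}
    {Sk Sk' : ℕ → AmbConfig d L n → ℝ} {c c' : ℕ → ℝ}
    (h : IsLuscherSeries B S Sk c) (h' : IsLuscherSeries B S Sk' c')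
    (hsm : ∀ k, ContDiff ℝ ∞ (Sk k)) (hsm' : ∀ k, ContDiff ℝ ∞ (Sk' k)) : c = c' :=
  funext fun k => (IsLuscherSeries.linkDeriv_eq h h' hsm hsm' k).1

end Uniqueness

end Summit.Ventures.LatticeQCDFlow.TrivializingMaps
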